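/-
Copyright (c) 2026 the pub-hodgecm-mathlib formalisation cell (harness21).  Prover seat hodgecm-mathlib-LH4-p04 (g8), req620 Track A «(D-RAM) FOUR-FRAME» squad
((β₂) road (R-36), β₂-BOARD v1.3 row (L-Σ), brick (L-Σ-aux-α): the `hclean` dictionary of row (AX-0) for the two type-(2) literal shapes), 2026-09-04.
-/
import Summits.HodgeConjecture.HodgeConjecture.Theorems.F0P3cDyRamLabelPlusCleanOfKernelCH   -- ★ p860242 (LH4-p14 (g6)): `latticeInLevel_sq_of_shell_of_labelPlus_of_kerCH` ((α′) type-uniform)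
import Literature.NumberTheory.Automorphic.UnitaryLatticeTreeAxisEndoFrame                  -- ★ `coe_endoGL_eq_endoShape` (the matrix of `ι(a, b)`)
import Summits.HodgeConjecture.HodgeConjecture.Theorems.F0P3cDyRamLabelCountDiagonalModel     -- ★ p859223 (LH4-p09 (g8)): `latticeLabelPlus_conj_mapGL_iff`; brings ★ p858764 `latticeInLevel_conj_mapGL_iff`, `latticeNearTransvShell_conj_mapGL_iff`, `coe_conj_sub_one[_mul_self]`
import Literature.NumberTheory.Automorphic.UnitaryLatticeTreeFrameChange                     -- ★ `isVertexLattice_formCongr_iff`, `mapGL_conj_mapGL_eq_iff`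
import HarnessLib

/-!
# Crux `H413`, line LH4 «(D-RAM) FOUR-FRAME» — (β₂) road, β₂-BOARD row (L-Σ), brick (L-Σ-aux-α): «THE CAYLEY–HAMILTON KERNEL OF `ι(γ₂, u)` IS THE W-PLANE» —
# (α′)₂ for the literal shape `Γ = endoGL (γ₂, u) ∈ U(σ, Φ₃)`: a fixed self-dual vertex on the `(ℓ₀, m*)` shell with label `+` has `(Γ − 1)²·M ⊆ ϖ^{m_c}·M`, given only that
# `tr γ₂ − 2` and `χ_{γ₂}(1)` are `ϖ^{m_c}`-deep

Helper lane `--supports stmt-HodgeConjecture-24833 --as helper` (count-neutral); THEOREMS ONLY (no `def`∕instance∕notation∕`sorry`, default heartbeats).  DATUM-FREE over a valued field `K`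
with a ramified quadratic datum `(σ, ϖ; d, t)`.
WHY.  LH4-p12 (g8)'s row (AX-0) «the axis column is zero» (SIG-AX0 v1 8d86092f) carries the per-vertex dictionary hypothesis `hclean` in the (α′)₂ shape: «shell `(ℓ, m*)` ∧ value set
`= V₊` ⇒ `LatticeInLevel ϖ m_c ((Γ−1)²)`» for the axis vertices `latt ι(g₂, 1)` of BOTH literals.  ★ p860242 proves (α′) for ANY `g ∈ U(σ, Φ₃)` from a Cayley–Hamilton kernel
`(π, s, p)` (`X²m = s·Xm − p·m` on `M ∩ ker π`) with `|s|·|ϖ|^{ℓ₀} ≤ |ϖ|^{m_c}`, `|p| ≤ |ϖ|^{m_c}`; at a type-(2) norm match of record the kernel is ★ p860334's rational `T`-stable plane.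
THIS FILE supplies the kernel for the LITERAL SHAPE `Γ = endoGL (γ₂, u)` DIRECTLY: `π := proj₁` (the W-plane `{m ∣ m 1 = 0}` is `Γ`-stable), `s := tr γ₂ − 2`, `p := det γ₂ − tr γ₂ + 1 = χ_{γ₂}(1)`
(Cayley–Hamilton for the `2 × 2` block, §1), whence (α′)₂ for `Γ` (§2 `latticeInLevel_sq_endoGL_of_shell_of_labelPlus`).  The sub-dealer's (L-Σ-3) discharges `hclean` with it (HYP
literal as is; ANISO literal after the conj-transport `P₁·endoGL (γ₁, u)·P₁⁻¹ ∈ U(Φ₃)` of ★ `latticeNearTransvShell_conj_mapGL_iff` ∕ ★ `latticeLabelPlus_conj_mapGL_iff`, same `s, p`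
by `hA12`), and makes `s, p` deep by a `V`-shrink (★ `exists_nhds_one_block_congr`).
HONEST LABEL.  Count-neutral; nothing asserted; (AX-0), β₂ and the typed letters stay HYPOTHESES; `HC_CM` is proved only modulo the 7 printed citations (2 remaining named inputs:
hLiu418 = `stmt-HodgeConjecture-24832`, h413 = `stmt-HodgeConjecture-24833`) until rung 0 closes.
## References
* [Rogawski1990] J. D. Rogawski, *Automorphic Representations of Unitary Groups in Three Variables*, Ann. of Math. Stud. 123 (1990), §4.8 Case (a) p. 53; §4.9 Prop. 4.9.1 (b) p. 55.
* [Kottwitz1986BaseChangeUnits] R. E. Kottwitz, *Base change for unit elements of Hecke algebras*, Compositio Math. 60 (1986), §1 pp. 240–241.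
* [Serre1979] J.-P. Serre, *Local Fields*, GTM 67 (1979), Ch. III §3 Prop. 7.
-/

set_option autoImplicit false

noncomputable section
namespace Summit.HodgeConjecture.HodgeConjecture.Cruxes.H413.F0P3cDyRamCleanLevelOfKernelCHBlock

open scoped Valued WithZero Matrix MatrixGroups
open Literature.NumberTheory.Automorphic Literature.NumberTheory.Automorphic.HermitianLattice Literature.NumberTheory.Automorphic.UnitaryGroup
open Literature.NumberTheory.Automorphic.UnitaryLatticeTree Literature.NumberTheory.Automorphic.UnitaryThreeFourFrame Literature.NumberTheory.Rogawski1990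
open Summit.HodgeConjecture.HodgeConjecture.Cruxes.H413.F0P3cDyRamFourFrameCensusDefs Summit.HodgeConjecture.HodgeConjecture.Cruxes.H413.F0P3cDyRamFourFramePieces
open Summit.HodgeConjecture.HodgeConjecture.Cruxes.H413.F0P3cDyRamStageOneBDefs Summit.HodgeConjecture.HodgeConjecture.Cruxes.H413.F0P3cDyRamLabelPlusCleanOfKernelCH
open Summit.HodgeConjecture.HodgeConjecture.Cruxes.H413.F0P3cDyRamLevelCountDiagonalModel Summit.HodgeConjecture.HodgeConjecture.Cruxes.H413.F0P3cDyRamLabelCountDiagonalModel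

variable {K : Type} [Field K] [Valued K ℤᵐ⁰]

/-! ## §1 Cayley–Hamilton on the W-plane for `ι(γ₂, u) − 1` -/

omit [Valued K ℤᵐ⁰] in
/-- **CAYLEY–HAMILTON KERNEL OF THE LITERAL SHAPE.**  For `Γ = endoGL (γ₂, u)` and `X = Γ − 1`, every `m` in the W-plane (`m 1 = 0`) satisfies
`X(Xm) = (tr γ₂ − 2)·Xm − (det γ₂ − tr γ₂ + 1)·m` — the `2 × 2` Cayley–Hamilton identity `(γ₂ − 1)² = (tr γ₂ − 2)(γ₂ − 1) − χ_{γ₂}(1)` read in the slots `0, 2`.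
[cite: Rogawski1990, §4.8 Case (a) p. 53] -/
theorem endoGL_sub_one_mulVec_mulVec_of_apply_one_eq_zero (γ₂ : GL (Fin 2) K) (u : GL (Fin 1) K) (m : Fin 3 → K) (hm : m (1 : Fin 3) = 0) :
    ((((endoGL (γ₂, u) : GL (Fin 3) K) : Matrix (Fin 3) (Fin 3) K) - 1)) *ᵥ (((((endoGL (γ₂, u) : GL (Fin 3) K) : Matrix (Fin 3) (Fin 3) K) - 1)) *ᵥ m) =
      ((γ₂ : Matrix (Fin 2) (Fin 2) K).trace - 2) • (((((endoGL (γ₂, u) : GL (Fin 3) K) : Matrix (Fin 3) (Fin 3) K) - 1)) *ᵥ m) -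
        ((γ₂ : Matrix (Fin 2) (Fin 2) K).det - (γ₂ : Matrix (Fin 2) (Fin 2) K).trace + 1) • m := by
  rw [coe_endoGL_eq_endoShape, Matrix.trace_fin_two, Matrix.det_fin_two]
  ext i
  fin_cases i <;>
    simp [Matrix.mulVec, dotProduct, Fin.sum_univ_three, Matrix.sub_apply, Matrix.one_apply, hm] <;> ring

/-! ## §2 (α′)₂ for `Γ = endoGL (γ₂, u) ∈ U(σ, Φ₃)` -/

/-- **(α′)₂ FOR THE LITERAL SHAPE `Γ = ι(γ₂, u)`.**  Ramified quadratic datum; `Γ = endoGL (γ₂, u) ∈ U(σ, Φ₃)`; `M` a type-0 vertex with `Γ·M = M` on the near-transvection shell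
`(ℓ₀, m*) = (d % 2, mstarOfRecord d)` of `X = Γ − 1` with `LatticeLabelPlus`; `|tr γ₂ − 2|·|ϖ|^{ℓ₀} ≤ |ϖ|^{m_c}` and `|χ_{γ₂}(1)| = |det γ₂ − tr γ₂ + 1| ≤ |ϖ|^{m_c}`
(`m_c = mcOfRecord d`; both hold near `1`).  THEN `X²·M ⊆ ϖ^{m_c}·M` — ★ p860242 with the W-plane kernel of §1 (`π := proj₁`).
[cite: Rogawski1990, §4.9 Prop. 4.9.1 (b) p. 55] [cite: Kottwitz1986BaseChangeUnits, §1 pp. 240–241] [cite: Serre1979, Ch. III §3 Prop. 7] -/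
theorem latticeInLevel_sq_endoGL_of_shell_of_labelPlus {σ : K →+* K} {ϖ : K} {d t : ℕ} (hD : IsRamifiedQuadraticDatum σ ϖ d t)
    (γ₂ : GL (Fin 2) K) (u : GL (Fin 1) K)
    (hΓ : endoGL (γ₂, u) ∈ unitaryGroupOfForm σ ((StdForm.antidiagonal 3).over K))
    {M : Submodule 𝒪[K] (Fin 3 → K)} (hM : IsVertexLattice σ ϖ ((StdForm.antidiagonal 3).over K) 0 M) (hfix : mapGL (endoGL (γ₂, u)) M = M)
    (hshell : LatticeNearTransvShell ϖ (d % 2) (mstarOfRecord d) ((((endoGL (γ₂, u) : GL (Fin 3) K) : Matrix (Fin 3) (Fin 3) K) - 1)) M)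
    (hlab : LatticeLabelPlus σ ϖ d (mstarOfRecord d) M ((((endoGL (γ₂, u) : GL (Fin 3) K) : Matrix (Fin 3) (Fin 3) K) - 1)))
    (hs : Valued.v ((γ₂ : Matrix (Fin 2) (Fin 2) K).trace - 2) * Valued.v (ϖ ^ (d % 2)) ≤ Valued.v (ϖ ^ mcOfRecord d))
    (hp : Valued.v ((γ₂ : Matrix (Fin 2) (Fin 2) K).det - (γ₂ : Matrix (Fin 2) (Fin 2) K).trace + 1) ≤ Valued.v (ϖ ^ mcOfRecord d)) :
    LatticeInLevel ϖ (mcOfRecord d) (((((endoGL (γ₂, u) : GL (Fin 3) K) : Matrix (Fin 3) (Fin 3) K) - 1)) * ((((endoGL (γ₂, u) : GL (Fin 3) K) : Matrix (Fin 3) (Fin 3) K) - 1))) M :=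
  latticeInLevel_sq_of_shell_of_labelPlus_of_kerCH hD hΓ hM hfix hshell hlab ((LinearMap.proj (1 : Fin 3) : (Fin 3 → K) →ₗ[K] K))
    (fun m _ hm => endoGL_sub_one_mulVec_mulVec_of_apply_one_eq_zero γ₂ u m hm) hs hp

/-! ## §3 (α′)₂ for the conjugate shape: `T′ = endoGL (γ₁, u)` unitary for the congruent form `H′ = ᵗσ(P₁) Φ₃ P₁` -/

omit [Valued K ℤᵐ⁰] in
/-- **THE KERNEL OF THE CONJUGATE.**  For `g = P₁·ι(γ₁, u)·P₁⁻¹` and `X = g − 1 = P₁ (T′ − 1) P₁⁻¹`: every `m` with `(P₁⁻¹ m) 1 = 0` (the plane `P₁·W`) satisfies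
`X(Xm) = (tr γ₁ − 2)·Xm − χ_{γ₁}(1)·m` (§1 transported). [cite: Rogawski1990, §4.8 Case (a) p. 53] -/
theorem conj_endoGL_sub_one_mulVec_mulVec_of_apply_one_eq_zero (P₁ : GL (Fin 3) K) (γ₁ : GL (Fin 2) K) (u : GL (Fin 1) K) (m : Fin 3 → K)
    (hm : (((P₁⁻¹ : GL (Fin 3) K) : Matrix (Fin 3) (Fin 3) K) *ᵥ m) (1 : Fin 3) = 0) :
    ((((P₁ * endoGL (γ₁, u) * P₁⁻¹ : GL (Fin 3) K)) : Matrix (Fin 3) (Fin 3) K) - 1) *ᵥ (((((P₁ * endoGL (γ₁, u) * P₁⁻¹ : GL (Fin 3) K)) : Matrix (Fin 3) (Fin 3) K) - 1) *ᵥ m) =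
      ((γ₁ : Matrix (Fin 2) (Fin 2) K).trace - 2) • (((((P₁ * endoGL (γ₁, u) * P₁⁻¹ : GL (Fin 3) K)) : Matrix (Fin 3) (Fin 3) K) - 1) *ᵥ m) -
        ((γ₁ : Matrix (Fin 2) (Fin 2) K).det - (γ₁ : Matrix (Fin 2) (Fin 2) K).trace + 1) • m := by
  have hPP : ((P₁⁻¹ : GL (Fin 3) K) : Matrix (Fin 3) (Fin 3) K) * (P₁ : Matrix (Fin 3) (Fin 3) K) = 1 := by
    rw [← Units.val_mul, inv_mul_cancel, Units.val_one]
  have hPP' : (P₁ : Matrix (Fin 3) (Fin 3) K) * ((P₁⁻¹ : GL (Fin 3) K) : Matrix (Fin 3) (Fin 3) K) = 1 := by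
    rw [← Units.val_mul, mul_inv_cancel, Units.val_one]
  have key := endoGL_sub_one_mulVec_mulVec_of_apply_one_eq_zero γ₁ u (((P₁⁻¹ : GL (Fin 3) K) : Matrix (Fin 3) (Fin 3) K) *ᵥ m) hm
  have e1 : ∀ w : Fin 3 → K, ((P₁⁻¹ : GL (Fin 3) K) : Matrix (Fin 3) (Fin 3) K) *ᵥ ((P₁ : Matrix (Fin 3) (Fin 3) K) *ᵥ w) = w := fun w => by
    rw [Matrix.mulVec_mulVec, hPP, Matrix.one_mulVec]
  have e2 : ∀ w : Fin 3 → K, (P₁ : Matrix (Fin 3) (Fin 3) K) *ᵥ (((P₁⁻¹ : GL (Fin 3) K) : Matrix (Fin 3) (Fin 3) K) *ᵥ w) = w := fun w => by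
    rw [Matrix.mulVec_mulVec, hPP', Matrix.one_mulVec]
  rw [F0P3cDyRamLevelCountDiagonalModel.coe_conj_sub_one]
  simp only [← Matrix.mulVec_mulVec]
  rw [e1, key, Matrix.mulVec_sub, Matrix.mulVec_smul, Matrix.mulVec_smul, e2]

/-- **(α′)₂ FOR THE CONJUGATE SHAPE (the anisotropic literal).**  `formCongr σ P₁ Φ₃ = H′`, `P₁·ι(γ₁,u)·P₁⁻¹ ∈ U(σ, Φ₃)`; `M` a type-0 vertex FOR `H′` with `ι(γ₁,u)·M = M` on the
`(ℓ₀, m*)` shell of `T′ − 1` whose `H′`-value set (precision `m*`) is `V₊ = valueSetMod σ ϖ m* (xPlus σ ϖ d)` (the label in ★ p861305 §3's block-form spelling); `tr γ₁ − 2` and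
`χ_{γ₁}(1)` `ϖ^{m_c}`-deep.  THEN `(T′ − 1)²·M ⊆ ϖ^{m_c}·M` — §2's proof transported along `M ↦ P₁·M` (★ `isVertexLattice_formCongr_iff`, ★ `mapGL_conj_mapGL_eq_iff`,
★ `latticeNearTransvShell_conj_mapGL_iff`, ★ `latticeLabelPlus_conj_mapGL_iff`, ★ `latticeInLevel_conj_mapGL_iff`).
[cite: Rogawski1990, §4.9 Prop. 4.9.1 (b) p. 55, Lemma 4.9.3 p. 56] [cite: Kottwitz1986BaseChangeUnits, §1 pp. 240–241] [cite: BruhatTits1972, §10] -/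
theorem latticeInLevel_sq_endoGL_of_shell_of_valueSet_eq_of_formCongr {σ : K →+* K} {ϖ : K} {d t : ℕ} (hD : IsRamifiedQuadraticDatum σ ϖ d t)
    (P₁ : GL (Fin 3) K) {H' : Matrix (Fin 3) (Fin 3) K} (hA : formCongr σ P₁ ((StdForm.antidiagonal 3).over K) = H')
    (γ₁ : GL (Fin 2) K) (u : GL (Fin 1) K) (hΓ : P₁ * endoGL (γ₁, u) * P₁⁻¹ ∈ unitaryGroupOfForm σ ((StdForm.antidiagonal 3).over K))
    {M : Submodule 𝒪[K] (Fin 3 → K)} (hM : IsVertexLattice σ ϖ H' 0 M) (hfix : mapGL (endoGL (γ₁, u)) M = M)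
    (hshell : LatticeNearTransvShell ϖ (d % 2) (mstarOfRecord d) (((endoGL (γ₁, u) : GL (Fin 3) K) : Matrix (Fin 3) (Fin 3) K) - 1) M)
    (hlab : {v | ∃ y ∈ M, Valued.v ((ϖ ^ mstarOfRecord d)⁻¹ * (v - pairing σ H' y ((((endoGL (γ₁, u) : GL (Fin 3) K) : Matrix (Fin 3) (Fin 3) K) - 1) *ᵥ y))) ≤ 1} = valueSetMod σ ϖ (mstarOfRecord d) (xPlus σ ϖ d))
    (hs : Valued.v ((γ₁ : Matrix (Fin 2) (Fin 2) K).trace - 2) * Valued.v (ϖ ^ (d % 2)) ≤ Valued.v (ϖ ^ mcOfRecord d))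
    (hp : Valued.v ((γ₁ : Matrix (Fin 2) (Fin 2) K).det - (γ₁ : Matrix (Fin 2) (Fin 2) K).trace + 1) ≤ Valued.v (ϖ ^ mcOfRecord d)) :
    LatticeInLevel ϖ (mcOfRecord d) ((((endoGL (γ₁, u) : GL (Fin 3) K) : Matrix (Fin 3) (Fin 3) K) - 1) * (((endoGL (γ₁, u) : GL (Fin 3) K) : Matrix (Fin 3) (Fin 3) K) - 1)) M := by
  subst hA
  have hM' : IsVertexLattice σ ϖ ((StdForm.antidiagonal 3).over K) 0 (mapGL P₁ M) :=
    (isVertexLattice_formCongr_iff (σ := σ) (ϖ := ϖ) P₁ _ 0 M).1 hM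
  have hfix' : mapGL (P₁ * endoGL (γ₁, u) * P₁⁻¹) (mapGL P₁ M) = mapGL P₁ M := (mapGL_conj_mapGL_eq_iff P₁ _ M).2 hfix
  have hshell' : LatticeNearTransvShell ϖ (d % 2) (mstarOfRecord d) ((((P₁ * endoGL (γ₁, u) * P₁⁻¹ : GL (Fin 3) K)) : Matrix (Fin 3) (Fin 3) K) - 1) (mapGL P₁ M) := by
    rw [F0P3cDyRamLevelCountDiagonalModel.coe_conj_sub_one, latticeNearTransvShell_conj_mapGL_iff]; exact hshell
  have hlab' : LatticeLabelPlus σ ϖ d (mstarOfRecord d) (mapGL P₁ M) ((((P₁ * endoGL (γ₁, u) * P₁⁻¹ : GL (Fin 3) K)) : Matrix (Fin 3) (Fin 3) K) - 1) := by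
    rw [F0P3cDyRamLevelCountDiagonalModel.coe_conj_sub_one, latticeLabelPlus_conj_mapGL_iff]; exact hlab
  have key := latticeInLevel_sq_of_shell_of_labelPlus_of_kerCH hD hΓ hM' hfix' hshell' hlab'
    (((LinearMap.proj (1 : Fin 3) : (Fin 3 → K) →ₗ[K] K)).comp (Matrix.toLin' ((P₁⁻¹ : GL (Fin 3) K) : Matrix (Fin 3) (Fin 3) K)))
    (fun m _ hm => conj_endoGL_sub_one_mulVec_mulVec_of_apply_one_eq_zero P₁ γ₁ u m (by simpa using hm)) hs hp
  rw [coe_conj_sub_one_mul_self, latticeInLevel_conj_mapGL_iff] at key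
  exact key

end Summit.HodgeConjecture.HodgeConjecture.Cruxes.H413.F0P3cDyRamCleanLevelOfKernelCHBlock

end
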